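import Summits.CriticalPhenomena.PercolationContinuityZ3.Theorems.Transplant.SkelPhiEquilibriumW2S
import Summits.CriticalPhenomena.PercolationContinuityZ3.Theorems.Transplant.SkelPhiSlideSplitBoth
import Summits.CriticalPhenomena.PercolationContinuityZ3.Theorems.Transplant.SkelPhiEquilibrium
import HarnessLib

/-!
# N2 (frames-only node `SamePDropOfSkeletonFrm₁`, OPEN), the (W1) LEVEL-0 family — **BOTH VERTICAL SIDES OF ONE SLID BOX LINKED WITHOUT SYMMETRY**:
# `Skelφ.Eq.exists_equilibriumW2S : … → BothSidesLinked2S G φ types p` (the sentence of hp-8's `SkelPhiEquilibriumW2S`, letter v1.3a, DISCHARGED)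

STATUS IN THE DESIGN (N2-SCOPE §17/§18, rulings (R-12)/(R-13) of 2026-08-22): this theorem completes the symmetry-free two-sided side family (MT17 Lemma 3.5's
side family with NO point symmetry); under the design of record (routes ORIENTED from the centred record, kit tier (S0) 'force the seed box') it has NO consumer
in N2's closure and is NOT on the trigger — it is landed as a finished LEVEL-0 theorem for later tiers.  The assembly of W1-SLIDING-SPLIT §3: stmt-g18's `Skelφ.Eq.exists_slide_sidePieces` (sliding split + localisation + one split per
side, at the slid base vertex `tc`, `φ tc = φ t + (s, 0)`) gives the FOUR side sub-segments of the rectangle `C_tc(n, 0, ℓ)` — right side below/above `uR`,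
left side below/above `−uL` (heights `σβ`) — each joined from the seed inside the rectangle with probability `≥ 1 − √(2√(2δ))`; with `δ := ε⁴/8` this is
`1 − ε` exactly.  (L7) re-centres both sides at once: integers `b, h` with `b + h = uR`, `|−uL − (b − h)| ≤ 1` (`exists_round_centres`); the slid box is
`pgramCylO φ t o n h ℓs` with `o = (s, b)`, split offsets `m(+1) = 0`, `m(−1) = n·(−uL − (b − h))` (`|m σ| ≤ n`), side height `ℓs = 2ℓ + 2`; every certified
sub-segment lies in the corresponding typed half `pgSideHalfS … σ τ (m σ)` and the rectangle lies in the tall region `pgramCylO φ t o n h (3ℓs)`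
(pure chart arithmetic, §1).  §2 is the truncation of MT17/KN to the fat region in the slid geometry (the fat part stays about `t`, as hp-8 typed it):
`real_openCrossing_le_linkInO_add` = `Eq.real_evPiece_le_linkIn_add` with `pgramCylO ⊆ cyl t (pgScaleO …)`.  §3 assembles.  No central inversion, no
Φ2, no `0 < p < 1`; the `hQs`/`hQx`/`t ∈ types`/`t ∈ SEED`/`1 ≤ M` inputs of the letter are not read (stmt's (L2)/(L3) derive the strip facts from
a.s. uniqueness).

builds on p205010 (kernel theorem, internal audit signed; external expert review pending) — nothing here uses p205010; NOTHING is claimed about the open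
node `SamePDropOfSkeletonFrm₁`: this file proves a LEVEL-0 lemma about strips and parallelograms.  Lane `prim-bschramm`, seat `prim-bschramm-p3`
(gen 14; N2 design owner); helper file (`--supports stmt-CriticalPhenomena-4575`).  Letter: hp-8 g37 (W2S v1.3); side family: stmt-g18; sieve: p5-g13.
[cite: MartineauTassion2017, §3.2 Lemma 3.3, Lemma 3.5 ((22)–(24)), Lemma 3.7] [cite: KozmaNitzan2024, §4 p. 20] [this work — W1 by the sliding split]
-/

noncomputable section

namespace Summit.CriticalPhenomena.PercolationContinuityZ3.Theorems.Transplant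

namespace Skelφ

namespace Eq

open MeasureTheory ProbabilityTheory Filter Topology Literature.Probability.Percolation Literature.Probability.LatticeModels SimpleGraph KNLevels
open scoped Classical

variable {V : Type} {G : SimpleGraph V} {φ : V → Site 2} {t : V}

/-! ## §1 Chart arithmetic of the slid box (offset `o = (s, b)`, base vertex `tc` at `(s, 0)`) -/

/-- **Rounding the two centres**: for any drift points `cL, cR` there are integers `b, h` with `b + h = cR` exactly and `|cL − (b − h)| ≤ 1`. [folklore] -/
theorem exists_round_centres (cL cR : ℤ) : ∃ b h : ℤ, b + h = cR ∧ |cL - (b - h)| ≤ 1 := by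
  refine ⟨(cL + cR) / 2, cR - (cL + cR) / 2, by ring, ?_⟩
  rw [abs_le]; constructor <;> omega

/-- **The rectangle at the slid base lies in the tall slid cylinder**: `C_tc(n, 0, ℓ) ⊆ C_o(n, h, L)` once `ℓ + |b| + |h| ≤ L` (`φ tc = φ t + (s,0)`, `o = (s,b)`).
[cite: MartineauTassion2017, §3.2 (24)] -/
theorem pgramCyl_base_subset_pgramCylO {tc : V} {s : ℤ} (htc : φ tc = φ t + Pi.single 0 s) {o : Site 2} (ho0 : o 0 = s) (n : ℕ) (h : ℤ) {ℓ k L : ℕ}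
    (hb : |o 1| ≤ k) (hh : |h| ≤ k) (hL : ℓ + 2 * k ≤ L) : pgramCyl φ tc n 0 ℓ ⊆ pgramCylO φ t o n h L := by
  intro w hw
  obtain ⟨e0, e1⟩ := relCoord_base htc w
  rw [mem_pgramCyl] at hw
  obtain ⟨hα, hβ⟩ := hw
  have hβ2 : |(n : ℤ) * relCoord φ tc 1 w - 0 * relCoord φ tc 0 w| ≤ n * ℓ := hβ
  rw [e0] at hα
  rw [e0, e1] at hβ2
  rw [mem_pgramCylO, relCoordO_apply, shearCoordO_apply, ho0]
  refine ⟨hα, ?_⟩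
  have hn0 : (0 : ℤ) ≤ n := by positivity
  have hβ' : |(n : ℤ) * relCoord φ t 1 w| ≤ n * ℓ := by simpa using hβ2
  have hk : ((ℓ : ℕ) : ℤ) + 2 * k ≤ L := by exact_mod_cast hL
  calc |(n : ℤ) * (relCoord φ t 1 w - o 1) - h * (relCoord φ t 0 w - s)|
      = |(n : ℤ) * relCoord φ t 1 w + (-((n : ℤ) * o 1)) + (-(h * (relCoord φ t 0 w - s)))| := by ring_nf
    _ ≤ |(n : ℤ) * relCoord φ t 1 w| + |(-((n : ℤ) * o 1))| + |(-(h * (relCoord φ t 0 w - s)))| := abs_add_three _ _ _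
    _ = |(n : ℤ) * relCoord φ t 1 w| + n * |o 1| + |h| * |relCoord φ t 0 w - s| := by rw [abs_neg, abs_neg, abs_mul, abs_mul, abs_mul, Nat.abs_cast]
    _ ≤ n * ℓ + n * k + k * n := by gcongr
    _ ≤ (n : ℤ) * L := by nlinarith

/-- **A certified side point lies in the typed side half** (the three cylinder-side conditions of `pgSideHalfS … σ τ (m σ)` with `m σ = n·(c − (b + σh))`):
on the side `α_tc = σn` of the rectangle `C_tc(n,0,ℓ)`, a vertex with `0 ≤ τ(β − c)` — where the split height `c` satisfies `|c| ≤ ℓ` and sits within one unit of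
`b + σh` — lies in `C_o(n, h, ℓs)` for `ℓs ≥ 2ℓ + 1`, on its side `σ`, in its half `τ`. [cite: MartineauTassion2017, §3.2 (22)–(23)] -/
theorem mem_halfS_of_side {tc : V} {s : ℤ} (htc : φ tc = φ t + Pi.single 0 s) {o : Site 2} (ho0 : o 0 = s) {n ℓ ℓs : ℕ} {h σ τ c : ℤ}
    (hσ : σ = 1 ∨ σ = -1) (hc : |c| ≤ ℓ) (hround : |c - (o 1 + σ * h)| ≤ 1) (hℓs : 2 * ℓ + 1 ≤ ℓs) {w : V} (hw : w ∈ pgramCyl φ tc n 0 ℓ)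
    (hα : relCoord φ tc 0 w = σ * n) (hτ : 0 ≤ τ * (relCoord φ tc 1 w - c)) :
    w ∈ pgramCylO φ t o n h ℓs ∧ relCoordO φ t o 0 w = σ * n ∧ 0 ≤ τ * (shearCoordO φ t o n h w - n * (c - (o 1 + σ * h))) := by
  obtain ⟨e0, e1⟩ := relCoord_base htc w
  rw [mem_pgramCyl] at hw
  obtain ⟨-, hβ⟩ := hw
  have hβ2 : |(n : ℤ) * relCoord φ tc 1 w - 0 * relCoord φ tc 0 w| ≤ n * ℓ := hβ
  rw [e0, e1] at hβ2
  rw [e0] at hα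
  rw [e1] at hτ
  have hn0 : (0 : ℤ) ≤ n := by positivity
  have hβ' : |(n : ℤ) * relCoord φ t 1 w| ≤ n * ℓ := by simpa using hβ2
  have hsh : shearCoordO φ t o n h w = n * (relCoord φ t 1 w - c) + n * (c - (o 1 + σ * h)) := by
    rw [shearCoordO_apply, ho0, hα]; ring
  have hα' : relCoordO φ t o 0 w = σ * n := by rw [relCoordO_apply, ho0, hα]
  refine ⟨?_, hα', ?_⟩
  · rw [mem_pgramCylO, hα', hsh]
    have hℓs' : (2 : ℤ) * ℓ + 1 ≤ ℓs := by exact_mod_cast hℓs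
    have h1 : |(n : ℤ) * c| ≤ n * ℓ := by rw [abs_mul, Nat.abs_cast]; exact mul_le_mul_of_nonneg_left hc hn0
    have h2 : |(n : ℤ) * (c - (o 1 + σ * h))| ≤ n * 1 := by rw [abs_mul, Nat.abs_cast]; exact mul_le_mul_of_nonneg_left hround hn0
    constructor
    · rw [abs_mul, Nat.abs_cast]; rcases hσ with rfl | rfl <;> simp
    · calc |(n : ℤ) * (relCoord φ t 1 w - c) + n * (c - (o 1 + σ * h))|
          = |(n : ℤ) * relCoord φ t 1 w + (-((n : ℤ) * c)) + n * (c - (o 1 + σ * h))| := by ring_nf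
        _ ≤ |(n : ℤ) * relCoord φ t 1 w| + |(-((n : ℤ) * c))| + |(n : ℤ) * (c - (o 1 + σ * h))| := abs_add_three _ _ _
        _ ≤ n * ℓ + n * ℓ + n * 1 := by rw [abs_neg]; gcongr
        _ ≤ (n : ℤ) * ℓs := by nlinarith
  · rw [hsh, add_sub_cancel_right, mul_left_comm]
    exact mul_nonneg hn0 hτ

/-- **The slid cylinder lies in the square cylinder of its planar scale**: `C_o(n, h, L) ⊆ cyl t (pgScaleO o n h L)` (`n ≥ 1`). [folklore] -/
theorem pgramCylO_subset_cyl (t : V) (o : Site 2) {n : ℕ} (hn : 1 ≤ n) (h : ℤ) (L : ℕ) : pgramCylO φ t o n h L ⊆ cyl φ t (pgScaleO o n h L) := by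
  intro w hw
  rw [mem_pgramCylO, relCoordO_apply, shearCoordO_apply, relCoord_apply, relCoord_apply] at hw
  obtain ⟨hα, hβ⟩ := hw
  have hn0 : (0 : ℤ) < n := by exact_mod_cast hn
  have hS0 : (n : ℤ) + |o 0| ≤ (pgScaleO o n h L : ℕ) := by
    have h1 : n + (o 0).natAbs ≤ pgScaleO o n h L := by unfold pgScaleO pgScale; omega
    rw [← Int.natCast_natAbs]; exact_mod_cast h1
  have hS1 : (L : ℤ) + |h| + |o 1| ≤ (pgScaleO o n h L : ℕ) := by
    have h1 : L + h.natAbs + (o 1).natAbs ≤ pgScaleO o n h L := by unfold pgScaleO pgScale; omega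
    rw [← Int.natCast_natAbs, ← Int.natCast_natAbs]; exact_mod_cast h1
  -- `|β − o 1| ≤ L + |h|`
  have hβ1 : |φ w 1 - φ t 1 - o 1| ≤ L + |h| := by
    have h1 : (n : ℤ) * |φ w 1 - φ t 1 - o 1| ≤ n * (L + |h|) := by
      calc (n : ℤ) * |φ w 1 - φ t 1 - o 1| = |(n : ℤ) * (φ w 1 - φ t 1 - o 1)| := by rw [abs_mul, Nat.abs_cast]
        _ = |((n : ℤ) * (φ w 1 - φ t 1 - o 1) - h * (φ w 0 - φ t 0 - o 0)) + h * (φ w 0 - φ t 0 - o 0)| := by ring_nf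
        _ ≤ |(n : ℤ) * (φ w 1 - φ t 1 - o 1) - h * (φ w 0 - φ t 0 - o 0)| + |h * (φ w 0 - φ t 0 - o 0)| := abs_add_le _ _
        _ ≤ n * L + |h| * n := by rw [abs_mul]; gcongr
        _ = n * (L + |h|) := by ring
    exact le_of_mul_le_mul_left h1 hn0
  rw [mem_cyl, mem_box]
  intro i
  fin_cases i
  · have h1 : |φ w 0 - φ t 0| ≤ n + |o 0| := by
      calc |φ w 0 - φ t 0| = |(φ w 0 - φ t 0 - o 0) + o 0| := by ring_nf
        _ ≤ |φ w 0 - φ t 0 - o 0| + |o 0| := abs_add_le _ _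
        _ ≤ n + |o 0| := by gcongr
    have h2 := abs_le.1 (h1.trans hS0)
    simpa using h2
  · have h1 : |φ w 1 - φ t 1| ≤ L + |h| + |o 1| := by
      calc |φ w 1 - φ t 1| = |(φ w 1 - φ t 1 - o 1) + o 1| := by ring_nf
        _ ≤ |φ w 1 - φ t 1 - o 1| + |o 1| := abs_add_le _ _
        _ ≤ L + |h| + |o 1| := by gcongr
    have h2 := abs_le.1 (h1.trans hS1)
    simpa using h2

/-- **The slid side halves clear the zone**: `|α| = |o 0 + σn| ≥ n − |o 0| > M`. [cite: MartineauTassion2017, §3.2 (B ∩ Z = ∅ for Z = L(a,u), L(u,b))] -/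
theorem disjoint_pgSideHalfS_cyl [G.LocallyFinite] (t : V) {o : Site 2} {M n : ℕ} (hMn : M + (o 0).natAbs < n) (h : ℤ) (L ℓ R : ℕ) {σ : ℤ}
    (hσ : σ = 1 ∨ σ = -1) (τ m : ℤ) : Disjoint (↑(pgSideHalfS G φ t o n h L ℓ R σ τ m) : Set V) (cyl φ t M) := by
  rw [Set.disjoint_left]
  intro w hw hM
  rw [Finset.mem_coe, mem_pgSideHalfS] at hw
  have hα := hw.2.2.1
  rw [relCoordO_apply, relCoord_apply] at hα
  rw [mem_cyl, mem_box] at hM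
  have h0 := hM 0
  simp only [Pi.sub_apply] at h0
  rcases hσ with rfl | rfl <;> omega

/-! ## §2 Truncation to the fat region in the slid geometry (fat part about `t`) -/

/-- **Truncation, probability form, slid region**: if the certified region `S₀ ⊆ C_o(n,h,L)` and every endpoint of `T` inside the fat slid region lies in the
finite piece `F`, then `P(SEED ↔ T in S₀) ≤ P(linkIn (pgramPrismO … (R+1)) SEED F) + P(⋃_{b∈SEED} cylReach t (pgScaleO o n h L) R b)`.
[cite: MartineauTassion2017, §3.2 Lemma 3.3 proof ((8)→B(k)); Lemma 3.7] [cite: KozmaNitzan2024, §4 p. 20 ((22)–(23))] -/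
theorem real_openCrossing_le_linkInO_add [Countable V] [G.LocallyFinite] (p : unitInterval) {n : ℕ} (hn : 1 ≤ n) (o : Site 2) (h : ℤ) (L R : ℕ)
    {S₀ : Set V} (hS₀ : S₀ ⊆ pgramCylO φ t o n h L) (SEED : Finset V) (hB : (↑SEED : Set V) ⊆ cylBall G φ t (pgScaleO o n h L) (R + 1)) {T : Set V}
    {F : Finset V} (hTF : ∀ y, y ∈ pgramPrismO G φ t o n h L (R + 1) → y ∈ T → y ∈ F) :
    (bondPercolation G p).real (openCrossing S₀ (↑SEED) T) ≤
      (bondPercolation G p).real (linkIn (pgramPrismO G φ t o n h L (R + 1)) SEED F) +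
        (bondPercolation G p).real (⋃ b ∈ SEED, cylReach G φ t (pgScaleO o n h L) R b) := by
  set μ := bondPercolation G p with hμ
  have hsub : ∀ᵐ ω ∂μ, ω ∈ openCrossing S₀ (↑SEED) T →
      ω ∈ linkIn (pgramPrismO G φ t o n h L (R + 1)) SEED F ∪ ⋃ b ∈ SEED, cylReach G φ t (pgScaleO o n h L) R b := by
    filter_upwards [(setBernoulli_ae_subset : ∀ᵐ ω ∂μ, ω ⊆ G.edgeSet)] with ω hω hev
    have hev' : ω ∈ openCrossing (pgramCylO φ t o n h L) ↑SEED T := openCrossing_mono hS₀ le_rfl le_rfl hev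
    rcases openCrossing_subset_window_union_cylReach hω (pgramCylO_subset_cyl t o hn h L) hB hev' with h1 | h2
    · left
      obtain ⟨b, hb, y, hy, hc⟩ := h1
      rw [linkIn_eq_openCrossing]
      have hyP : y ∈ pgramPrismO G φ t o n h L (R + 1) := by obtain ⟨-, hy', -⟩ := hc; exact hy'
      exact ⟨b, hb, y, Finset.mem_coe.2 (hTF y hyP hy), hc⟩
    · exact Or.inr h2
  calc μ.real (openCrossing S₀ (↑SEED) T)
      ≤ μ.real (linkIn (pgramPrismO G φ t o n h L (R + 1)) SEED F ∪ ⋃ b ∈ SEED, cylReach G φ t (pgScaleO o n h L) R b) := by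
        rw [measureReal_def, measureReal_def]; exact ENNReal.toReal_mono (measure_ne_top _ _) (measure_mono_ae hsub)
    _ ≤ _ := measureReal_union_le _ _

/-! ## §3 The assembly -/

/-- The half condition `0 ≤ τ(β − σu)` of a vertex of the certified sub-segment of side `σ` split at `u` (heights `σβ`): the piece ABOVE the split (`σβ ≥ u`)
serves the half `τ = σ`, the piece BELOW it (`σβ ≤ u`) the half `τ = −σ`. [folklore] -/
theorem half_cond_of_sideSeg {tc : V} {n ℓ : ℕ} {σ τ u x y : ℤ} (hσ : σ = 1 ∨ σ = -1) (hτ : τ = 1 ∨ τ = -1)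
    (hxy : (σ * τ = 1 → x = u) ∧ (σ * τ = -1 → y = u)) {w : V} (hw : w ∈ sideSeg φ tc n 0 ℓ σ x y) :
    w ∈ pgramCyl φ tc n 0 ℓ ∧ relCoord φ tc 0 w = σ * n ∧ 0 ≤ τ * (relCoord φ tc 1 w - σ * u) := by
  rw [mem_sideSeg] at hw
  obtain ⟨hC, hα, hx, hy⟩ := hw
  refine ⟨hC, hα, ?_⟩
  rcases hσ with rfl | rfl <;> rcases hτ with rfl | rfl <;> norm_num at hxy hx hy ⊢ <;> linarith

/-- **(W1) BOTH VERTICAL SIDES LINKED, SYMMETRY-FREE — the sentence `BothSidesLinked2S` holds** under the two-axis dictionary `Lip`/`Steps`/`Frames` and a.s.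
uniqueness of the infinite cluster (no central inversion, no Φ2, no `0 < p < 1`): for every base vertex `t ∈ types`, zone `M ≥ 1`, seed `SEED ⊆ cyl t M` with
`P(SEED ↔ ∞) ≥ 1 − ε³²` (`0 < ε`, `2ε ≤ 1`) and radius data `R` with tails `≤ ε₀`, for all large widths `n` there is a slid box `C_o(n, h, ℓs)`, `o = (s, b)`,
`M + |s| < n`, whose four side halves (split offsets `|m σ| ≤ n`) clear the zone and are each linked from the seed inside the fat tall region with probability
`≥ 1 − ε − ε₀`.  Proof: `exists_slide_sidePieces` with `δ := ε⁴/8` (`√(2√(2δ)) = ε`, `ε³² ≤ δ` as `2ε ≤ 1`), §1, §2.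
[cite: MartineauTassion2017, §3.2 Lemma 3.5] [this work — W1 by the sliding split, N2-SCOPE v3 §16.1] -/
theorem exists_equilibriumW2S [Countable V] [G.LocallyFinite] {types : Finset V} (hc : G.Preconnected) (hlip : Lip G φ) (hst : Steps G φ)
    (hfr : Frames G φ types) {p : unitInterval} (hU : ∀ᵐ ω ∂bondPercolation G p, numInfiniteClusters ω ≤ 1) :
    BothSidesLinked2S G φ types p := by
  intro t _ M _ SEED _ hSM _ _ ε ε₀ hε0 hε1 hseed R hR1 hSR hRt
  set μ := bondPercolation G p with hμ
  -- the seed column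
  have hSM0 : ∀ x ∈ SEED, |relCoord φ t 0 x| ≤ M := by
    intro x hx
    have hx' := hSM (Finset.mem_coe.2 hx)
    rw [mem_cyl, mem_box] at hx'
    have h0 := hx' 0
    simp only [Pi.sub_apply] at h0
    rw [relCoord_apply]; exact abs_le.2 ⟨h0.1, h0.2⟩
  -- accuracy bookkeeping: `δ := ε⁴/8`, so that `√(2√(2δ)) = ε`
  set δ : ℝ := ε ^ 4 / 8 with hδ
  have hε1' : ε ≤ 1 / 2 := by linarith
  have hδ0 : 0 < δ := by positivity
  have hsq1 : Real.sqrt (2 * δ) = ε ^ 2 / 2 := by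
    rw [show 2 * δ = (ε ^ 2 / 2) ^ 2 by rw [hδ]; ring]
    exact Real.sqrt_sq (by positivity)
  have hsq2 : Real.sqrt (2 * Real.sqrt (2 * δ)) = ε := by
    rw [hsq1, show 2 * (ε ^ 2 / 2) = ε ^ 2 by ring]
    exact Real.sqrt_sq hε0.le
  have hδ1 : 2 * Real.sqrt (2 * δ) < 1 := by rw [hsq1]; nlinarith
  have hseed' : 1 - δ ≤ μ.real (TwoAxis.SeedPerc (↑SEED : Set V)) := by
    have h28 : ε ^ 28 ≤ (1 / 2) ^ 28 := pow_le_pow_left₀ hε0.le hε1' 28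
    have h4 : 0 ≤ ε ^ 4 := by positivity
    have h32 : ε ^ 32 ≤ δ := by
      rw [hδ, show ε ^ 32 = ε ^ 28 * ε ^ 4 by ring]
      have : (1 / 2 : ℝ) ^ 28 ≤ 1 / 8 := by norm_num
      nlinarith
    linarith
  obtain ⟨n₀, hn₀⟩ := exists_slide_sidePieces (t := t) hc hfr hst hlip hU SEED hSM0 hδ0 hδ1 hseed'
  refine ⟨max n₀ (M + 1), fun n hn => ?_⟩
  have hn0 : n₀ ≤ n := le_trans (le_max_left _ _) hn
  have hMn : M + 1 ≤ n := le_trans (le_max_right _ _) hn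
  have hn1 : 1 ≤ n := by omega
  have hnz : (0 : ℤ) ≤ n := by positivity
  obtain ⟨tc, s, ℓ, uL, uR, htc, hs, huL, huR, hP⟩ := hn₀ n hn0
  rw [hsq2] at hP
  -- (L7) the two centres, the offset, the split offsets, the side height
  obtain ⟨b, h, hbh, hround⟩ := exists_round_centres (-uL) uR
  set r : ℤ := -uL - (b - h) with hr
  set o : Site 2 := ![s, b] with ho
  have ho0 : o 0 = s := by simp [ho]
  have ho1 : o 1 = b := by simp [ho]
  set m : ℤ → ℤ := fun σ => if σ = -1 then (n : ℤ) * r else 0 with hm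
  set ℓs : ℕ := 2 * ℓ + 2 with hℓs
  set L : ℕ := pgScaleO o n h (3 * ℓs) with hL
  have hnL : n ≤ L := by rw [hL]; unfold pgScaleO pgScale; omega
  have hML : M ≤ L := by omega
  set R₀ : ℕ := R L - 1 with hR₀
  have hRL : R L = R₀ + 1 := by have := hR1 L hML; omega
  have hBall : (↑SEED : Set V) ⊆ cylBall G φ t (pgScaleO o n h (3 * ℓs)) (R₀ + 1) := by rw [← hL, ← hRL]; exact hSR L hML
  have htail : μ.real (⋃ x ∈ SEED, cylReach G φ t (pgScaleO o n h (3 * ℓs)) R₀ x) ≤ ε₀ := by rw [← hL]; exact hRt L hML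
  -- integer bookkeeping of the centres
  have huL' := abs_le.1 huL
  have huR' := abs_le.1 huR
  have hround' := abs_le.1 hround
  have hs' := abs_le.1 hs
  have hbk : |o 1| ≤ (ℓ + 1 : ℕ) := by rw [ho1]; push_cast; rw [abs_le]; constructor <;> omega
  have hhk : |h| ≤ (ℓ + 1 : ℕ) := by push_cast; rw [abs_le]; constructor <;> omega
  have hrect : pgramCyl φ tc n 0 ℓ ⊆ pgramCylO φ t o n h (3 * ℓs) :=
    pgramCyl_base_subset_pgramCylO htc ho0 n h hbk hhk (by omega)
  -- the certified piece of the half `(σ, τ)`, its probability and its geometry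
  have piece : ∀ σ τ : ℤ, (σ = 1 ∨ σ = -1) → (τ = 1 ∨ τ = -1) →
      ∃ (T : Set V) (cσ : ℤ), |cσ| ≤ ℓ ∧ |cσ - (o 1 + σ * h)| ≤ 1 ∧ m σ = n * (cσ - (o 1 + σ * h)) ∧
        1 - ε ≤ μ.real (evPiece φ tc ↑SEED n 0 ℓ T) ∧
        ∀ w ∈ T, w ∈ pgramCyl φ tc n 0 ℓ ∧ relCoord φ tc 0 w = σ * n ∧ 0 ≤ τ * (relCoord φ tc 1 w - cσ) := by
    intro σ τ hσ hτ
    obtain ⟨hA, hB⟩ := hP σ hσ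
    rcases hσ with rfl | rfl
    · simp only [if_true] at hA hB
      have hc1 : |uR - (o 1 + 1 * h)| ≤ 1 := by rw [ho1, show uR - (b + 1 * h) = 0 by rw [← hbh]; ring]; simp
      have hm1 : m 1 = n * (uR - (o 1 + 1 * h)) := by rw [ho1, show uR - (b + 1 * h) = 0 by rw [← hbh]; ring]; simp [hm]
      rcases hτ with rfl | rfl
      · exact ⟨_, uR, huR, hc1, hm1, hB, fun w hw => by
          simpa using half_cond_of_sideSeg (u := uR) (Or.inl rfl) (Or.inl rfl) ⟨fun _ => rfl, fun h' => by norm_num at h'⟩ hw⟩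
      · exact ⟨_, uR, huR, hc1, hm1, hA, fun w hw => by
          simpa using half_cond_of_sideSeg (u := uR) (Or.inl rfl) (Or.inr rfl) ⟨fun h' => by norm_num at h', fun _ => rfl⟩ hw⟩
    · simp only [show (-1 : ℤ) ≠ 1 by decide, if_false] at hA hB
      have huL2 : |(-uL)| ≤ ℓ := by rw [abs_neg]; exact huL
      have hc1 : |-uL - (o 1 + -1 * h)| ≤ 1 := by rw [ho1, show -uL - (b + -1 * h) = r by rw [hr]; ring]; exact hround
      have hm1 : m (-1) = n * (-uL - (o 1 + -1 * h)) := by rw [ho1, show -uL - (b + -1 * h) = r by rw [hr]; ring]; simp [hm]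
      rcases hτ with rfl | rfl
      · exact ⟨_, -uL, huL2, hc1, hm1, hA, fun w hw => by
          simpa using half_cond_of_sideSeg (u := uL) (Or.inr rfl) (Or.inl rfl) ⟨fun h' => by norm_num at h', fun _ => rfl⟩ hw⟩
      · exact ⟨_, -uL, huL2, hc1, hm1, hB, fun w hw => by
          simpa using half_cond_of_sideSeg (u := uL) (Or.inr rfl) (Or.inr rfl) ⟨fun _ => rfl, fun h' => by norm_num at h'⟩ hw⟩
  refine ⟨o, h, ℓs, m, ?_, ?_, fun σ τ hσ hτ => ⟨?_, ?_⟩⟩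
  · -- (a) the slide is admissible
    rw [ho0]; omega
  · -- the split offsets are within one chart unit
    intro σ
    by_cases hσ1 : σ = -1
    · simp only [hm, hσ1, if_true]
      rw [abs_mul, Nat.abs_cast]
      calc (n : ℤ) * |r| ≤ n * 1 := mul_le_mul_of_nonneg_left hround hnz
        _ = n := mul_one _
    · simp only [hm, hσ1, if_false, abs_zero]; exact hnz
  · -- zone clearance
    exact disjoint_pgSideHalfS_cyl t (by rw [ho0]; omega) h _ _ _ hσ τ (m σ)
  · -- the link, truncated to the fat tall region
    obtain ⟨T, cσ, hcℓ, hc1, hmσ, hTP, hTgeom⟩ := piece σ τ hσ hτ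
    rw [hRL]
    have htrunc := real_openCrossing_le_linkInO_add (t := t) p hn1 o h (3 * ℓs) R₀ hrect SEED hBall (T := T)
      (F := pgSideHalfS G φ t o n h (3 * ℓs) ℓs (R₀ + 1) σ τ (m σ))
      (fun y hy hyT => by
        obtain ⟨hyC, hyα, hyτ⟩ := hTgeom y hyT
        rw [mem_pgSideHalfS, hmσ]
        exact ⟨hy, mem_halfS_of_side htc ho0 hσ hcℓ hc1 (by omega) hyC hyα hyτ⟩)
    have hTP' : 1 - ε ≤ μ.real (openCrossing (pgramCyl φ tc n 0 ℓ) ↑SEED T) := hTP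
    linarith

end Eq

end Skelφ

end Summit.CriticalPhenomena.PercolationContinuityZ3.Theorems.Transplant

end
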